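import Summits.Ventures.HodgeRepro2.T5InertHeckeCharacter

/-!
# The Satake parameter of a `T₁`-eigenvalue: existence and uniqueness up to inversion
(cell pub-hodge-repro2, seat p3)

Tier-5 N3 support. With the normalisation of the Satake transform as printed — `T₁ ↦ q²(X + X⁻¹) + (q − 1)`
for the unramified `U(2,1)` — the Satake parameter `α` of a spherical representation with `T₁`-eigenvalue
`λ` is a non-zero solution of `q²(α + α⁻¹) + (q − 1) = λ`, determined up to `α ↦ α⁻¹`. This file records
the elementary algebra behind that sentence, over any algebraically closed field and for any `q ≠ 0`:

* **`exists_param`** — for every `λ` there is `α ≠ 0` with `q²(α + α⁻¹) + (q − 1) = λ` (a root of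
  `X² − ((λ − (q − 1))/q²) X + 1`, whose constant term `1` keeps it away from `0`);
* **`param_eq_or_eq_inv`** — two such parameters agree or are inverse to each other;
* **`exists_param_algHom`** — for every character `χ : H(U(J₃(u)), K) →ₐ[k] k` there is such an `α` for
  `λ = χ(T₁)`, and (file 188) `χ` is determined by it.

The normalisation itself (the `q²` and the `q − 1`) is the printed input (T5-SATAKE-KERNEL-p3.md row 12);
this file only says that, once it is read, the parameter exists and is well defined up to the Weyl group.

Mathlib + this seat's file 188; no display; no device. §8(d): uses an L-value-free non-vanishing device: NO.
-/

namespace Summit.Ventures.HodgeRepro2.T5InertSatakeParameter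

open Summit.Ventures.HodgeRepro2.T5HeckeBasisCells Summit.Ventures.HodgeRepro2.T5HermitianThreeElements
  Summit.Ventures.HodgeRepro2.T5UnitaryHeckeAdjoint Summit.Ventures.HodgeRepro2.T5HeckePermutationModule

section Algebra

variable {k : Type*} [Field k]

/-- A non-zero `α` with `α + α⁻¹ = c` is a root of `X² − c X + 1`, and conversely. -/
theorem add_inv_eq_iff {α c : k} (hα : α ≠ 0) : α + α⁻¹ = c ↔ α ^ 2 - c * α + 1 = 0 := by
  constructor
  · intro h
    have : α * (α + α⁻¹) = α * c := by rw [h]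
    rw [mul_add, mul_inv_cancel₀ hα] at this
    linear_combination this
  · intro h
    have : α * (α + α⁻¹) = α * c := by
      rw [mul_add, mul_inv_cancel₀ hα]
      linear_combination h
    exact mul_left_cancel₀ hα this

/-- **Existence of the Satake parameter**: over an algebraically closed field, for every `λ` and every
`q ≠ 0` there is `α ≠ 0` with `q² (α + α⁻¹) + (q − 1) = λ`. -/
theorem exists_param [IsAlgClosed k] (q : k) (hq : q ≠ 0) (lam : k) :
    ∃ α : k, α ≠ 0 ∧ q ^ 2 * (α + α⁻¹) + (q - 1) = lam := by
  set c : k := (lam - (q - 1)) / q ^ 2 with hc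
  have hdeg : (Polynomial.X ^ 2 - Polynomial.C c * Polynomial.X + 1 : Polynomial k).degree ≠ 0 := by
    rw [Polynomial.degree_add_eq_left_of_degree_lt, Polynomial.degree_sub_eq_left_of_degree_lt,
      Polynomial.degree_X_pow]
    · exact_mod_cast (two_ne_zero : (2 : ℕ) ≠ 0)
    · rw [Polynomial.degree_X_pow]
      exact (Polynomial.degree_C_mul_X_le c).trans_lt (by exact_mod_cast one_lt_two)
    · rw [Polynomial.degree_sub_eq_left_of_degree_lt, Polynomial.degree_X_pow, Polynomial.degree_one]
      · exact_mod_cast two_pos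
      · rw [Polynomial.degree_X_pow]
        exact (Polynomial.degree_C_mul_X_le c).trans_lt (by exact_mod_cast one_lt_two)
  obtain ⟨α, hα⟩ := IsAlgClosed.exists_root _ hdeg
  rw [Polynomial.IsRoot, Polynomial.eval_add, Polynomial.eval_sub, Polynomial.eval_pow, Polynomial.eval_mul,
    Polynomial.eval_C, Polynomial.eval_X, Polynomial.eval_one] at hα
  have hα0 : α ≠ 0 := by
    rintro rfl
    simp at hα
  refine ⟨α, hα0, ?_⟩
  rw [(add_inv_eq_iff hα0).2 hα, hc]
  field_simp
  ring

/-- **Uniqueness up to the Weyl group**: two non-zero solutions of `α + α⁻¹ = c` agree or are inverse to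
each other. -/
theorem param_eq_or_eq_inv {α β c : k} (hα : α ≠ 0) (hβ : β ≠ 0) (h₁ : α + α⁻¹ = c)
    (h₂ : β + β⁻¹ = c) : β = α ∨ β = α⁻¹ := by
  have h : (β - α) * (β - α⁻¹) = 0 := by
    have e2 := (add_inv_eq_iff hβ).1 h₂
    have : β ^ 2 - (α + α⁻¹) * β + 1 = 0 := by rw [h₁]; exact e2
    have hαα : α * α⁻¹ = 1 := mul_inv_cancel₀ hα
    linear_combination this + hαα
  rcases mul_eq_zero.1 h with h | h
  · exact Or.inl (sub_eq_zero.1 h)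
  · exact Or.inr (sub_eq_zero.1 h)

/-- Two Satake parameters of the same eigenvalue (same `q`) agree or are inverse to each other. -/
theorem param_eq_or_eq_inv' {q α β lam : k} (hq : q ≠ 0) (hα : α ≠ 0) (hβ : β ≠ 0)
    (h₁ : q ^ 2 * (α + α⁻¹) + (q - 1) = lam) (h₂ : q ^ 2 * (β + β⁻¹) + (q - 1) = lam) :
    β = α ∨ β = α⁻¹ := by
  have hq2 : q ^ 2 ≠ 0 := pow_ne_zero 2 hq
  refine param_eq_or_eq_inv hα hβ (c := (lam - (q - 1)) / q ^ 2) ?_ ?_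
  · rw [eq_div_iff hq2]
    linear_combination h₁
  · rw [eq_div_iff hq2]
    linear_combination h₂

end Algebra

section Hecke

variable {R E : Type*} [CommRing R] [Field E] [StarRing E] [Algebra R E] [IsFractionRing R E] [IsDomain R]
  [IsDiscreteValuationRing R] [Finite (IsLocalRing.ResidueField R)]
  (hstar : ∀ x : E, IsLocalization.IsInteger R x → IsLocalization.IsInteger R (star x))
  (u : E) (hsu : star u = u) (hu0 : u ≠ 0) (hu : IsLocalization.IsInteger R u)
  (hu' : IsLocalization.IsInteger R u⁻¹) {ϖ : R} (hϖ : Irreducible ϖ)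
  (hs : star (algebraMap R E ϖ) = algebraMap R E ϖ) (k : Type*) [Field k]

/-- **The Satake parameter of a character of `H(U(J₃(u)), K)`**: for every `χ : H →ₐ[k] k` (`k`
algebraically closed) and `q ≠ 0` there is `α ≠ 0` with `q² (α + α⁻¹) + (q − 1) = χ(T₁)`; by file 188
`χ` is determined by `χ(T₁)`, hence by `α`. -/
theorem exists_param_algHom [IsAlgClosed k] (q : k) (hq : q ≠ 0)
    (χ : heckeAlgebra k (hyperspecialSubgroup R (J3 u)) →ₐ[k] k) :
    ∃ α : k, α ≠ 0 ∧ q ^ 2 * (α + α⁻¹) + (q - 1) = χ (heckeBasisCells hstar u hsu hu0 hu hu' hϖ hs k 1) :=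
  exists_param q hq _

end Hecke

end Summit.Ventures.HodgeRepro2.T5InertSatakeParameter
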